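import Mathlib
import Literature.Barriers.MatrixMultiplication.NormalizerBarrier
import Summits.MatrixMultiplication.MatrixMultiplication.Theorems.LevelOneGL2Designs.Negative.LevelSpace

/-!
# The twisted double-coset sieve: a subgroup identity design forces `(α, γ)`-equivariant separators
(negative-side structure lemma for the crux `SubgroupIdentityDesigns`, stmt-MatrixMultiplication-14079;
cell B2b-5 `b2b-lgcu-borel`, gen 11 — report `run/shared/lean/b2b/levelgraded-cu/ORACLE-g11.md` §G11-4;
this is the soundness of "stage I2" (twisted sieve) of the census engine `census_gen.c`, refining the
bi-invariant sieve of `Negative/DoubleCosetSieve.lean`)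

Let `(H₁, H₂, H₃)` be a subgroup-TPP triple of `GL_m(𝔽_p)`, `f ∈ F_k|_G = levelSubmodule p m k` a
level-`k` identity test on the triple products (`f 1 = 1`, `f (a b c) = 0` whenever `a b c ≠ 1`), and
`α : H₁ → ℂˣ`, `γ : H₃ → ℂˣ` linear characters.  The TWISTED AVERAGE
`F(x) = ∑_{a ∈ H₁} ∑_{c ∈ H₃} α(a) γ(c) f(a x c)` lies in `F_k|_G` (`twAvg_mem`), is
`(α, γ)`-EQUIVARIANT — `F(a₀ x) = α(a₀)⁻¹ F(x)`, `F(x c₀) = γ(c₀)⁻¹ F(x)` (`twAvg_mul_left/right`) — takes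
the value `1` at the identity (TPP: the only pair with `a c = 1` is `(1,1)`; `twAvg_one`) and vanishes on
every triple product `a b c` with `b ≠ 1` (`twAvg_eq_zero`).  Hence (`exists_twisted_separator`) a design
forces, for EVERY pair of linear characters, an equivariant level-`k` separator of the identity double
coset; if for some `(α, γ)` the equivariant part of `F_k|_G` admits none — a linear-algebra question on the
double cosets `H₁ x H₃ ⊆ H₁H₂H₃`, decided by the engine's stage I2 — the identity-design clause of the crux
FAILS for `(H₁, H₂, H₃)` at level `k` (`no_design_of_no_twisted_separator`).  With `α = γ = 1` this is the
bi-invariant sieve.  Sorry-free; no definitions (the twisted average is written out in every statement).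
VALUE = necessary condition behind the (3,1,3) census verdicts, NOT summit progress; the crux stays open.
-/

set_option linter.dupNamespace false

noncomputable section

open scoped BigOperators Classical Matrix

namespace Summit.MatrixMultiplication.MatrixMultiplication.Theorems.SubgroupIdentityDesigns.Negative
namespace TwistedCosetSieve

open Summit.MatrixMultiplication.MatrixMultiplication.Theorems.LieRankDesigns.Negative (GLm Mat fourierFn)
open Summit.MatrixMultiplication.MatrixMultiplication.Theorems.LevelOneGL2Designs.Negative
  (levelSubmodule levelSubmodule_bi_inv fourierFn_mem_levelSubmodule)
open Literature.Barriers.MatrixMultiplication (SubgroupTPP)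

variable {p m k : ℕ} [hp : Fact p.Prime]

/-- The twisted average of a level-`k` function is a level-`k` function. -/
theorem twAvg_mem (H₁ H₃ : Subgroup (GLm p m)) (α : H₁ →* ℂˣ) (γ : H₃ →* ℂˣ) {f : GLm p m → ℂ}
    (hf : f ∈ levelSubmodule p m k) :
    (fun x => ∑ a : H₁, ∑ c : H₃, ((α a : ℂˣ) : ℂ) * ((γ c : ℂˣ) : ℂ) * f ((a : GLm p m) * x * c)) ∈
      levelSubmodule p m k := by
  have hfun : (fun x => ∑ a : H₁, ∑ c : H₃,
      ((α a : ℂˣ) : ℂ) * ((γ c : ℂˣ) : ℂ) * f ((a : GLm p m) * x * c)) =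
      ∑ a : H₁, ∑ c : H₃, ((((α a : ℂˣ) : ℂ) * ((γ c : ℂˣ) : ℂ)) •
        (fun x : GLm p m => f ((a : GLm p m) * x * c))) := by
    ext x; simp [Finset.sum_apply, smul_eq_mul]
  rw [hfun]
  exact Submodule.sum_mem _ fun a _ => Submodule.sum_mem _ fun c _ =>
    Submodule.smul_mem _ _ (levelSubmodule_bi_inv f hf _ _)

/-- Left equivariance, multiplicative form: `α(a₀) · F(a₀ x) = F(x)` (reindex `a ↦ a a₀`). -/
theorem mul_twAvg_mul_left (H₁ H₃ : Subgroup (GLm p m)) (α : H₁ →* ℂˣ) (γ : H₃ →* ℂˣ)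
    (f : GLm p m → ℂ) (a₀ : H₁) (x : GLm p m) :
    ((α a₀ : ℂˣ) : ℂ) * (∑ a : H₁, ∑ c : H₃,
        ((α a : ℂˣ) : ℂ) * ((γ c : ℂˣ) : ℂ) * f ((a : GLm p m) * ((a₀ : GLm p m) * x) * c)) =
      ∑ a : H₁, ∑ c : H₃, ((α a : ℂˣ) : ℂ) * ((γ c : ℂˣ) : ℂ) * f ((a : GLm p m) * x * c) := by
  rw [Finset.mul_sum]
  let e : H₁ ≃ H₁ := Equiv.mulRight a₀
  symm
  refine Fintype.sum_equiv e.symm _ _ fun a => ?_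
  rw [Finset.mul_sum]
  refine Finset.sum_congr rfl fun c _ => ?_
  have ha : a = (e.symm a) * a₀ := by simp [e]
  conv_lhs => rw [ha]
  simp only [map_mul, Units.val_mul, Subgroup.coe_mul, mul_assoc]
  ring

/-- Left equivariance: `F(a₀ x) = α(a₀)⁻¹ F(x)`. -/
theorem twAvg_mul_left (H₁ H₃ : Subgroup (GLm p m)) (α : H₁ →* ℂˣ) (γ : H₃ →* ℂˣ)
    (f : GLm p m → ℂ) (a₀ : H₁) (x : GLm p m) :
    (∑ a : H₁, ∑ c : H₃,
        ((α a : ℂˣ) : ℂ) * ((γ c : ℂˣ) : ℂ) * f ((a : GLm p m) * ((a₀ : GLm p m) * x) * c)) =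
      (((α a₀)⁻¹ : ℂˣ) : ℂ) *
        ∑ a : H₁, ∑ c : H₃, ((α a : ℂˣ) : ℂ) * ((γ c : ℂˣ) : ℂ) * f ((a : GLm p m) * x * c) := by
  rw [← mul_twAvg_mul_left H₁ H₃ α γ f a₀ x, Units.inv_mul_cancel_left]

/-- Right equivariance, multiplicative form: `γ(c₀) · F(x c₀) = F(x)` (reindex `c ↦ c₀ c`). -/
theorem mul_twAvg_mul_right (H₁ H₃ : Subgroup (GLm p m)) (α : H₁ →* ℂˣ) (γ : H₃ →* ℂˣ)
    (f : GLm p m → ℂ) (c₀ : H₃) (x : GLm p m) :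
    ((γ c₀ : ℂˣ) : ℂ) * (∑ a : H₁, ∑ c : H₃,
        ((α a : ℂˣ) : ℂ) * ((γ c : ℂˣ) : ℂ) * f ((a : GLm p m) * (x * (c₀ : GLm p m)) * c)) =
      ∑ a : H₁, ∑ c : H₃, ((α a : ℂˣ) : ℂ) * ((γ c : ℂˣ) : ℂ) * f ((a : GLm p m) * x * c) := by
  rw [Finset.mul_sum]
  refine Finset.sum_congr rfl fun a _ => ?_
  rw [Finset.mul_sum]
  let e : H₃ ≃ H₃ := Equiv.mulLeft c₀
  symm
  refine Fintype.sum_equiv e.symm _ _ fun c => ?_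
  have hc : c = c₀ * (e.symm c) := by simp [e]
  conv_lhs => rw [hc]
  simp only [map_mul, Units.val_mul, Subgroup.coe_mul, mul_assoc]
  ring

/-- Right equivariance: `F(x c₀) = γ(c₀)⁻¹ F(x)`. -/
theorem twAvg_mul_right (H₁ H₃ : Subgroup (GLm p m)) (α : H₁ →* ℂˣ) (γ : H₃ →* ℂˣ)
    (f : GLm p m → ℂ) (c₀ : H₃) (x : GLm p m) :
    (∑ a : H₁, ∑ c : H₃,
        ((α a : ℂˣ) : ℂ) * ((γ c : ℂˣ) : ℂ) * f ((a : GLm p m) * (x * (c₀ : GLm p m)) * c)) =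
      (((γ c₀)⁻¹ : ℂˣ) : ℂ) *
        ∑ a : H₁, ∑ c : H₃, ((α a : ℂˣ) : ℂ) * ((γ c : ℂˣ) : ℂ) * f ((a : GLm p m) * x * c) := by
  rw [← mul_twAvg_mul_right H₁ H₃ α γ f c₀ x, Units.inv_mul_cancel_left]

variable {H₁ H₂ H₃ : Subgroup (GLm p m)}

/-- Under the TPP, the twisted average of an identity test is `1` at the identity. -/
theorem twAvg_one (α : H₁ →* ℂˣ) (γ : H₃ →* ℂˣ) (htpp : SubgroupTPP H₁ H₂ H₃) {f : GLm p m → ℂ}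
    (hf1 : f 1 = 1) (hf0 : ∀ a ∈ H₁, ∀ b ∈ H₂, ∀ c ∈ H₃, a * b * c ≠ 1 → f (a * b * c) = 0) :
    (∑ a : H₁, ∑ c : H₃, ((α a : ℂˣ) : ℂ) * ((γ c : ℂˣ) : ℂ) * f ((a : GLm p m) * 1 * c)) = 1 := by
  rw [Finset.sum_eq_single (1 : H₁)]
  · rw [Finset.sum_eq_single (1 : H₃)]
    · simp [hf1]
    · intro c _ hc
      have hne : (1 : GLm p m) * 1 * (c : GLm p m) ≠ 1 := by
        intro h
        have := (htpp 1 H₁.one_mem 1 H₂.one_mem c c.2 h).2.2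
        exact hc (Subtype.ext this)
      have h0 : f (((1 : H₁) : GLm p m) * 1 * c) = 0 := by
        simpa using hf0 1 H₁.one_mem 1 H₂.one_mem c c.2 hne
      rw [h0, mul_zero]
    · simp
  · intro a _ ha
    refine Finset.sum_eq_zero fun c _ => ?_
    have hne : (a : GLm p m) * 1 * (c : GLm p m) ≠ 1 := by
      intro h
      have := (htpp a a.2 1 H₂.one_mem c c.2 h).1
      exact ha (Subtype.ext this)
    rw [hf0 a a.2 1 H₂.one_mem c c.2 hne, mul_zero]
  · simp

/-- Under the TPP, the twisted average of an identity test vanishes on every triple product with a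
non-trivial middle factor. -/
theorem twAvg_eq_zero (α : H₁ →* ℂˣ) (γ : H₃ →* ℂˣ) (htpp : SubgroupTPP H₁ H₂ H₃)
    {f : GLm p m → ℂ} (hf0 : ∀ a ∈ H₁, ∀ b ∈ H₂, ∀ c ∈ H₃, a * b * c ≠ 1 → f (a * b * c) = 0)
    {a₀ b c₀ : GLm p m} (ha₀ : a₀ ∈ H₁) (hb : b ∈ H₂) (hc₀ : c₀ ∈ H₃) (hb1 : b ≠ 1) :
    (∑ a : H₁, ∑ c : H₃,
      ((α a : ℂˣ) : ℂ) * ((γ c : ℂˣ) : ℂ) * f ((a : GLm p m) * (a₀ * b * c₀) * c)) = 0 := by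
  refine Finset.sum_eq_zero fun a _ => Finset.sum_eq_zero fun c _ => ?_
  have hmem₁ : (a : GLm p m) * a₀ ∈ H₁ := H₁.mul_mem a.2 ha₀
  have hmem₃ : c₀ * (c : GLm p m) ∈ H₃ := H₃.mul_mem hc₀ c.2
  have hne : (a : GLm p m) * a₀ * b * (c₀ * c) ≠ 1 := fun h =>
    hb1 (htpp _ hmem₁ b hb _ hmem₃ h).2.1
  have h0 := hf0 _ hmem₁ b hb _ hmem₃ hne
  have hassoc : (a : GLm p m) * (a₀ * b * c₀) * c = (a : GLm p m) * a₀ * b * (c₀ * c) := by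
    simp [mul_assoc]
  rw [hassoc, h0, mul_zero]

/-- **THE TWISTED SIEVE (necessary condition).**  If a subgroup-TPP triple `(H₁, H₂, H₃)` of
`GL_m(𝔽_p)` carries a level-`k` identity test, then for EVERY pair of linear characters
`α : H₁ → ℂˣ`, `γ : H₃ → ℂˣ` the space `F_k|_G` contains an `(α, γ)`-equivariant function
(`F(a x) = α(a)⁻¹ F(x)`, `F(x c) = γ(c)⁻¹ F(x)`) with `F(1) = 1` that vanishes on every triple product
`a b c` with `b ≠ 1`. -/
theorem exists_twisted_separator (α : H₁ →* ℂˣ) (γ : H₃ →* ℂˣ) (htpp : SubgroupTPP H₁ H₂ H₃)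
    (hdes : ∃ f ∈ levelSubmodule p m k, f 1 = 1 ∧
      ∀ a ∈ H₁, ∀ b ∈ H₂, ∀ c ∈ H₃, a * b * c ≠ 1 → f (a * b * c) = 0) :
    ∃ F ∈ levelSubmodule p m k,
      (∀ (a : H₁) (x : GLm p m), F ((a : GLm p m) * x) = (((α a)⁻¹ : ℂˣ) : ℂ) * F x) ∧
      (∀ (c : H₃) (x : GLm p m), F (x * (c : GLm p m)) = (((γ c)⁻¹ : ℂˣ) : ℂ) * F x) ∧
      F 1 = 1 ∧ (∀ a ∈ H₁, ∀ b ∈ H₂, ∀ c ∈ H₃, b ≠ 1 → F (a * b * c) = 0) := by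
  obtain ⟨f, hf, hf1, hf0⟩ := hdes
  exact ⟨fun x => ∑ a : H₁, ∑ c : H₃, ((α a : ℂˣ) : ℂ) * ((γ c : ℂˣ) : ℂ) * f ((a : GLm p m) * x * c),
    twAvg_mem H₁ H₃ α γ hf, fun a x => twAvg_mul_left H₁ H₃ α γ f a x,
    fun c x => twAvg_mul_right H₁ H₃ α γ f c x, twAvg_one α γ htpp hf1 hf0,
    fun a ha b hb c hc hb1 => twAvg_eq_zero α γ htpp hf0 ha hb hc hb1⟩

/-- The same in the crux's own vocabulary (`c` supported on `rk M ≤ k`, `f = fourierFn c`). -/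
theorem exists_twisted_separator_of_design (α : H₁ →* ℂˣ) (γ : H₃ →* ℂˣ)
    (htpp : SubgroupTPP H₁ H₂ H₃)
    (hdes : ∃ c : Mat p m → ℂ, (∀ M, k < M.rank → c M = 0) ∧
      (∑ M, c M * ZMod.stdAddChar (Matrix.trace (M * ((1 : GLm p m) : Mat p m)))) = 1 ∧
      ∀ a ∈ H₁, ∀ b ∈ H₂, ∀ g ∈ H₃, a * b * g ≠ 1 →
        (∑ M, c M * ZMod.stdAddChar (Matrix.trace (M * ((a * b * g : GLm p m) : Mat p m)))) = 0) :
    ∃ F ∈ levelSubmodule p m k,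
      (∀ (a : H₁) (x : GLm p m), F ((a : GLm p m) * x) = (((α a)⁻¹ : ℂˣ) : ℂ) * F x) ∧
      (∀ (c : H₃) (x : GLm p m), F (x * (c : GLm p m)) = (((γ c)⁻¹ : ℂˣ) : ℂ) * F x) ∧
      F 1 = 1 ∧ (∀ a ∈ H₁, ∀ b ∈ H₂, ∀ c ∈ H₃, b ≠ 1 → F (a * b * c) = 0) := by
  obtain ⟨c, hc, hc1, hc0⟩ := hdes
  exact exists_twisted_separator α γ htpp
    ⟨fourierFn c, fourierFn_mem_levelSubmodule hc, hc1, fun a ha b hb g hg hne => hc0 a ha b hb g hg hne⟩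

/-- **Contrapositive (the twisted sieve as a FAIL criterion).**  If for some pair of linear characters
`(α, γ)` no `(α, γ)`-equivariant level-`k` function with `F 1 = 1` vanishes on the triple products with
non-trivial middle factor, the identity-design clause of the crux fails for `(H₁, H₂, H₃)` at level `k`. -/
theorem no_design_of_no_twisted_separator (α : H₁ →* ℂˣ) (γ : H₃ →* ℂˣ)
    (htpp : SubgroupTPP H₁ H₂ H₃)
    (hno : ¬ ∃ F ∈ levelSubmodule p m k,
      (∀ (a : H₁) (x : GLm p m), F ((a : GLm p m) * x) = (((α a)⁻¹ : ℂˣ) : ℂ) * F x) ∧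
      (∀ (c : H₃) (x : GLm p m), F (x * (c : GLm p m)) = (((γ c)⁻¹ : ℂˣ) : ℂ) * F x) ∧
      F 1 = 1 ∧ (∀ a ∈ H₁, ∀ b ∈ H₂, ∀ c ∈ H₃, b ≠ 1 → F (a * b * c) = 0)) :
    ¬ ∃ c : Mat p m → ℂ, (∀ M, k < M.rank → c M = 0) ∧
      (∑ M, c M * ZMod.stdAddChar (Matrix.trace (M * ((1 : GLm p m) : Mat p m)))) = 1 ∧
      ∀ a ∈ H₁, ∀ b ∈ H₂, ∀ g ∈ H₃, a * b * g ≠ 1 →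
        (∑ M, c M * ZMod.stdAddChar (Matrix.trace (M * ((a * b * g : GLm p m) : Mat p m)))) = 0 :=
  fun hdes => hno (exists_twisted_separator_of_design α γ htpp hdes)

end TwistedCosetSieve
end Summit.MatrixMultiplication.MatrixMultiplication.Theorems.SubgroupIdentityDesigns.Negative

end
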